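import Literature.NumberTheory.Sieve.LinearEquationsInPrimesLevelTwoInputs
import Literature.NumberTheory.Sieve.LinearEquationsInPrimesSharpUniform
import HarnessLib

/-!
# Linear equations in primes, level 2: the sharp estimate (12.6)₂ holds — `SharpTwo_holds`

Trunk T-SIEVE (`Literature/NumberTheory/Sieve`). This file DISCHARGES the named fact
`Literature.NumberTheory.Sieve.GreenTaoLevelTwo.SharpTwo` of
`LinearEquationsInPrimesLevelTwoInputs.lean` (B. Green, T. Tao, *Linear equations in primes*,
Ann. of Math. 171 (2010), display (12.6) at level `s = 2`: for some admissible cutoff `χ`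
(`χ(x) = x` on `[0, ½]`, Lipschitz) and some `γ > 0`,
`‖Λ♯_{χ,N^γ,b,W} − 1‖_{U³[N]} = o(1)` uniformly in the `W`-trick range), as the `s = 2` instance
of the tree's theorem `GreenTao2010_sharpGoldstonYildirim_holds`
(`LinearEquationsInPrimesSharpUniform.lean`: (12.6) for every `s`, from Thm. D.3 with `a_i = 1`).
With it the level-2 assembly `GreenTao2010_mainTheorem_of_le_four_of_inputs` needs only
`HeisMetricExists`, `GITwo` and `MNTwo` (`GreenTao2010_mainTheorem_of_le_four_of_metric_of_GI_of_MN`,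
`GreenTao2010_gowersUniformityAt_two_of_metric_of_GI_of_MN`).

## References

* B. Green, T. Tao, *Linear equations in primes*, Ann. of Math. (2) 171 (2010), 1753–1850:
  §12, (12.6); App. D, Thm. D.3 and "The correlation estimate for `Λ♯`" (p. 1834). [GreenTao2010]
-/

noncomputable section

namespace Literature.NumberTheory.Sieve

namespace GreenTaoLevelTwo

/-- **(12.6) at level 2 holds**: `SharpTwo` is the `s = 2` instance of
`GreenTao2010_sharpGoldstonYildirim_holds` (cutoff `x·β(x)`, `γ = 2^{-5}`).
[cite: GreenTao2010, §12 (12.6) and App. D, p. 1834] -/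
theorem SharpTwo_holds : SharpTwo :=
  GreenTao2010_sharpGoldstonYildirim_holds 2 (by norm_num)

end GreenTaoLevelTwo

open GreenTaoLevelTwo in
/-- **Level 2 of Thm. 7.2 from an explicit metric and the two deep inputs**: with (12.6)₂ proved, a
compatible box-comparable metric + `GI(2)` + `MN(2)` on the Heisenberg class give
`GreenTao2010_gowersUniformityAt 2`. [cite: GreenTao2010, Thm. 7.2 (proof, §12) and (12.6)] -/
theorem GreenTao2010_gowersUniformityAt_two_of_metric_of_GI_of_MN (hD : HeisMetricExists)
    (hGI : GITwo) (hMN : MNTwo) : GreenTao2010_gowersUniformityAt 2 := by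
  obtain ⟨d, h, hc⟩ := hD
  exact gowersUniformityAt_two_of (heisGood_with d h) (hGI d h hc) (hMN d h hc) SharpTwo_holds

open GreenTaoLevelTwo in
/-- **The level-2 rung from an explicit metric and the two deep inputs**: with (12.6)₂ proved, a
compatible box-comparable metric + `GI(2)` + `MN(2)` on the Heisenberg class give the Main Theorem
of Green–Tao 2010 for every finite-complexity system of `t ≤ 4` forms.
[cite: GreenTao2010, Thm. 7.2, Main Theorem and (12.6)] -/
theorem GreenTao2010_mainTheorem_of_le_four_of_metric_of_GI_of_MN (hD : HeisMetricExists)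
    (hGI : GITwo) (hMN : MNTwo) : MainTheoremLeFour :=
  GreenTao2010_mainTheorem_of_le_four_of_inputs hD hGI hMN SharpTwo_holds

end Literature.NumberTheory.Sieve

end
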